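import Mathlib
import Literature.NumberTheory.LFunctions.WeilFirstPrimeOddMarginDCheck
import Literature.NumberTheory.LFunctions.WeilFirstPrimeQuadratic
import Literature.NumberTheory.LFunctions.WeilFirstPrimePositivityC
import Summits.RiemannHypothesis.RiemannHypothesis.Theorems.WeilGroundStateGroundStateSimpleEvenOddMarginSound
import Summits.RiemannHypothesis.RiemannHypothesis.Theorems.WeilGroundStateGroundStateSimpleEvenStubLogAtoms
import HarnessLib

/-!
# Crux `GroundStateSimpleEven` (stmt-RiemannHypothesis-1526), line `parity-multiplicity-commutator` (v5):
# stub `stub_oddLowerD` — the certified odd-sector lower bound at `c = Real.log 3 / 2`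

Support file (`--supports stmt-RiemannHypothesis-1526`). Every `L²`-normalised ODD window-`c` test function
has `Re Q(g) ≥ κ − κ' = 138017886645630860717094787844671/21267647932558653966460912964485513216 ≈ 6.4896e-06`: the odd-sector margin certificate `weilCertOddD`
(`Literature/NumberTheory/LFunctions/WeilFirstPrimeOddMarginDataD.lean`, a₀ = 563/1024; kernel-checked Booleans in
`…DCheck.lean`) fed to the odd-margin soundness theorem `stub_oddMarginSound`
(`…OddMarginSound.lean`: `(κ − κ')‖g‖₂² ≤ E₂(g)` for odd `g` on `[-a₀, a₀]`), and `E₂ = Re Q` on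
`C((log 3)/2)` (`weilQuadratic_re_eq_weilFirstPrimeQuadratic`).
-/

noncomputable section

open Set MeasureTheory
open Literature.NumberTheory.LFunctions

namespace Summit.RiemannHypothesis.RiemannHypothesis.Theorems.GroundStateSimpleEven

set_option linter.dupNamespace false in
/-- The odd-sector margin bound of certificate D: for every ODD test function `g` supported in
`[-(Real.log 3 / 2), Real.log 3 / 2]`, `(κ − κ') ‖g‖₂² ≤ Re Q(g)` with `κ − κ' = 138017886645630860717094787844671/21267647932558653966460912964485513216`. [folklore] -/
theorem oddMarginD {g : ℝ → ℂ} (hg : IsWeilTest g)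
    (hsupp : tsupport g ⊆ Icc (-(Real.log 3 / 2 : ℝ)) (Real.log 3 / 2)) (hodd : ∀ x, g (-x) = -g x) :
    (138017886645630860717094787844671/21267647932558653966460912964485513216 : ℝ) * weilNorm2Sq g ≤ (weilQuadratic g).re := by
  have hb : tsupport g ⊆ Icc (-((weilCertOddD.b : ℚ) : ℝ)) ((weilCertOddD.b : ℚ) : ℝ) := by
    have e : weilCertOddD.b = weilCert3C.b := rfl
    rw [e]
    exact hsupp.trans (Icc_subset_Icc (by linarith [log_three_half_le_certb]) log_three_half_le_certb)
  have h3 : tsupport g ⊆ Icc (-(Real.log 3 / 2)) (Real.log 3 / 2) :=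
    hsupp
  have hκ := kappa'_nonneg_le_weilCertOddD
  have h := Summit.RiemannHypothesis.RiemannHypothesis.Theorems.stub_oddMarginSound weilCertOddD weilCertOddDKappa'
    checkCells_weilCertOddD checkScalars_weilCertOddD checkNu_weilCertOddD checkBlock1_weilCertOddD hκ.1 hκ.2 g hg hb hodd
  rw [weilQuadratic_re_eq_weilFirstPrimeQuadratic hg h3]
  have e2 : (((weilCertOddD.kappaQ - weilCertOddDKappa' : ℚ) : ℚ) : ℝ) = (138017886645630860717094787844671/21267647932558653966460912964485513216 : ℝ) := by
    rw [kappaQ_weilCertOddD]; unfold weilCertOddDKappa'; norm_num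
  rw [e2] at h
  exact h

end Summit.RiemannHypothesis.RiemannHypothesis.Theorems.GroundStateSimpleEven

namespace Summit.RiemannHypothesis.RiemannHypothesis.Theorems

set_option linter.dupNamespace false in
/-- **Registered sub-goal (LD) of line `parity-multiplicity-commutator` (v5): the certified odd-sector
lower bound at `c = Real.log 3 / 2`** — every `L²`-normalised ODD window-`c` test function has `Re Q ≥ 6 / 1000000`
(odd-sector margin certificate D, margin `κ − κ' ≈ 6.4896e-06`). [folklore] -/
theorem stub_oddLowerD :
    ∀ g : ℝ → ℂ, IsWeilTest g → tsupport g ⊆ Icc (-(Real.log 3 / 2)) (Real.log 3 / 2) →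
      ∫ x, ‖g x‖ ^ 2 = (1 : ℝ) → (∀ x, g (-x) = -g x) → (6 / 1000000 : ℝ) ≤ (weilQuadratic g).re := by
  intro g hg hs hn ho
  have h := GroundStateSimpleEven.oddMarginD hg hs ho
  rw [show weilNorm2Sq g = 1 from hn, mul_one] at h
  refine le_trans (by norm_num) h

end Summit.RiemannHypothesis.RiemannHypothesis.Theorems
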